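import Literature.MathematicalPhysics.QuantumFieldTheory.Balaban1983to89.Node00.Record12BgRowAnalysis
import Literature.MathematicalPhysics.QuantumFieldTheory.Balaban1983to89.B15Claim189N0OfRecord

/-!
# NODE 00 — ROW P11: the COMPARABILITY of the small-field thresholds `ε_m ≤ 2ε_{m+1}` along a history ([III] (2.6)–(2.8)),
# DISCHARGED from the window + a one-step β-box (the run clause `hcomp` of the faithful named fact `VariationalThm1ScaledSep`)

Cell `pub-ymgap`, seat `pub-ymgap-node00-def-P11` g2 (R218 ∕ OPS-NOTE-16; director-ym №136 (2), plan g67 WORD-136 (2)∕(D), dag-lead WORDS-137∕138).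
[III] = [Balaban1988Convergent]; [I] = [Balaban1987RG1].

HONEST FRAMING.  Elementary real inequalities about the profile `ε(g) = g·A₀·(log g⁻²)^{p₀}` of (2.4) along a coupling history: nothing of Bałaban is
asserted or discharged; no β-function bound is asserted (every β-hypothesis below is DISPLAYED); K0‴ NOT closed; counts unmoved (typed 28∕28 ·
discharged 5∕28); one finite `𝕋⁴` torus family at fixed `ε = L^{−K}`; not continuum ∕ OS ∕ mass gap ∕ Clay.  No `def`, no `instance`, no `sorry`.

THE CLAUSE.  The faithful per-scale named fact `VariationalThm1ScaledSep` (FILE 2 §8) carries, besides the separation of the (2.18) sequence, the RUN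
clause «thresholds comparable across consecutive scales» `∀ n < k, δ n ≤ 2·δ (n+1)`, read at the record as `cR·ε_m(g) ≤ 2·cR·ε_{m+1}(g)` along the
history `g` (FILE 5 v1.2 `bgRowAt_of_thm1ScaledSep (hcomp)`, node00-def-K0a 11b `bgSep_of_thm1ScaledSep (hcomp)`).  It is print's (2.6)–(2.8) [III]
pp. 255–256 («the coupling constants g_j satisfy the inequalities … (1+β₀)g_n, n > m … They follow from the renormalization group equations (0.20) [I],
and from the properties of the β-functions. They imply … ε_m ≤ (1+β₀)(1 + O(1)g²(n−m))^{p₀} ε_n (2.8)»): a property of the RUN, consequence of the RG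
equations and β-function bounds — NOT of the window `0 < g_j ≤ γ` alone (located, INBOX l.16599: `g_m = γ, g_{m+1} = γ∕100` is in the window and
violates it), and NOT of the window plus the sign `β ≥ 0` alone when `p₀ ≥ 2`, `γ = ½` (`ε` increases only on `]0, e^{−p₀}]`; a monotone pair
`g_m = e^{−p₀} ≤ g_{m+1} = ½` has `ε_m∕ε_{m+1} = 2·(2p₀∕(e·log 4))^{p₀}` = 2.25 at p₀ = 2).

CONTENTS.  §1 one RG step (`B14FlowStep.log_inv_sq_nonneg` by name): `log_inv_sq_le_of_step` (`g⁻² ≤ g′⁻² + β′`, `log g′⁻² ≥ 1` ⇒ `log g⁻² ≤ (1 + β′g′²)·log g′⁻²`), `p0Profile_le_of_step`,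
★ `epsOfRecord_le_mul_succ_of_step` (`g_m ≤ c·g_{m+1}` ∧ `g_m⁻² ≤ g_{m+1}⁻² + β′` ⇒ `ε_m ≤ c·(1 + β′g_{m+1}²)^{p₀}·ε_{m+1}`), `epsOfRecord_le_two_mul_succ_of_step`
(the clause under ONE letter `c·(1 + β′γ²)^{p₀} ≤ 2`).  §2 the monotone regime: `mul_log_inv_sq_pow_mono` (`x ↦ x(log x⁻²)^{p₀}` increases on `]0, e^{−p₀}]`,
by `1 + t ≤ eᵗ`), `epsOfRecord_le_of_le` (`0 < g_m ≤ g_{m+1} ≤ e^{−p₀}` ⇒ `ε_m ≤ ε_{m+1}`).  §3 along the generated history `genSeq β g₀` of (0.20):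
`inv_sq_genSeq_succ` (the RG step in the window), ★ `hcomp_genSeq_of_betaBox` (window + `FlowStep.BetaLowerH 0 γ β` + `FlowStep.BetaUpperH β′ γ β` +
the letter `(1 + β′γ²)^{p₀} ≤ 2` ⇒ `ε_m ≤ 2ε_{m+1}` for `m < n`), `hcomp_genSeq_of_betaLowerH_small` (sign + `γ ≤ e^{−p₀}` ⇒ `ε_m ≤ ε_{m+1}`),
`hcomp_mul_of_hcomp` (the `cR`-form 11b∕FILE 5 display).

DEPENDENCES (by name): `epsOfRecord`, `p0Profile`, FILE 2 `one_le_log_inv_sq`; `FlowStepRuns.genSeq`∕`genSeq_succ`∕`solveCoupling_nonpos`∕`inv_sq_solveCoupling`;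
`FlowStep.BetaLowerH`∕`BetaUpperH`∕`mem_box`∕`prefixOf`; `B14FlowStep.log_inv_sq_nonneg`; `B15Claim189N0OfRecord.genSeq_le_succ_of_beta_nonneg`∕`betaAlongHistory_nonneg_of_betaLowerH`; `Step.InInterval`.
-/

noncomputable section

namespace Literature.MathematicalPhysics.QuantumFieldTheory.Balaban1983to89.Node00

open FlowStep (HBeta prefixOf Box mem_box BetaLowerH BetaUpperH)
open FlowStepRuns (genSeq genSeq_succ solveCoupling solveCoupling_nonpos inv_sq_solveCoupling)
open B15Claim189N0OfRecord (genSeq_le_succ_of_beta_nonneg betaAlongHistory_nonneg_of_betaLowerH)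
open B14FlowStep (log_inv_sq_nonneg)

/-! ## §1  One RG step: `ε_m ≤ c·(1 + β′g_{m+1}²)^{p₀}·ε_{m+1}` -/

section Step

/-- **ONE RG STEP AT THE LOGARITHM**: `g⁻² ≤ g′⁻² + β′` (`0 ≤ β′`, i.e. `β_{m+1}(g_m) ≤ β′` in (0.20)) and `log g′⁻² ≥ 1` give
`log g⁻² ≤ (1 + β′·g′²)·log g′⁻²` (`log(1 + t) ≤ t`). [cite: Balaban1988Convergent, (2.6)–(2.8) pp.255–256; Balaban1987RG1, (0.20) p.256] -/
theorem log_inv_sq_le_of_step {g g' β' : ℝ} (hg : 0 < g) (hg' : 0 < g') (hβ : 0 ≤ β') (hlog : 1 ≤ Real.log (g' ^ 2)⁻¹)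
    (hstep : (g ^ 2)⁻¹ ≤ (g' ^ 2)⁻¹ + β') : Real.log (g ^ 2)⁻¹ ≤ (1 + β' * g' ^ 2) * Real.log (g' ^ 2)⁻¹ := by
  have hg2 : 0 < g ^ 2 := by positivity
  have hg'2 : 0 < g' ^ 2 := by positivity
  have hfac : (g' ^ 2)⁻¹ + β' = (g' ^ 2)⁻¹ * (1 + β' * g' ^ 2) := by field_simp
  have hpos1 : 0 < 1 + β' * g' ^ 2 := by positivity
  calc Real.log (g ^ 2)⁻¹ ≤ Real.log ((g' ^ 2)⁻¹ + β') := Real.log_le_log (inv_pos.mpr hg2) hstep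
    _ = Real.log (g' ^ 2)⁻¹ + Real.log (1 + β' * g' ^ 2) := by
        rw [hfac, Real.log_mul (ne_of_gt (inv_pos.mpr hg'2)) (ne_of_gt hpos1)]
    _ ≤ Real.log (g' ^ 2)⁻¹ + β' * g' ^ 2 := by
        gcongr
        have := Real.add_one_le_exp (β' * g' ^ 2)
        calc Real.log (1 + β' * g' ^ 2) ≤ Real.log (Real.exp (β' * g' ^ 2)) :=
              Real.log_le_log hpos1 (by linarith)
          _ = β' * g' ^ 2 := Real.log_exp _
    _ ≤ (1 + β' * g' ^ 2) * Real.log (g' ^ 2)⁻¹ := by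
        have h0 : 0 ≤ β' * g' ^ 2 := by positivity
        nlinarith

/-- **ONE RG STEP AT THE PROFILE** `A₀(log g⁻²)^{p₀}` of (2.4): under the same step hypotheses and `0 < g ≤ 1`, `0 ≤ A₀`,
`A₀(log g⁻²)^{p₀} ≤ (1 + β′g′²)^{p₀}·A₀(log g′⁻²)^{p₀}`. [cite: Balaban1988Convergent, (2.4) p.255, (2.8) p.256] -/
theorem p0Profile_le_of_step {A₀ g g' β' : ℝ} {p₀ : ℕ} (hA : 0 ≤ A₀) (hg : 0 < g) (hg1 : g ≤ 1) (hg' : 0 < g') (hβ : 0 ≤ β')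
    (hlog : 1 ≤ Real.log (g' ^ 2)⁻¹) (hstep : (g ^ 2)⁻¹ ≤ (g' ^ 2)⁻¹ + β') :
    p0Profile A₀ p₀ g ≤ (1 + β' * g' ^ 2) ^ p₀ * p0Profile A₀ p₀ g' := by
  unfold p0Profile
  have h1 := log_inv_sq_le_of_step hg hg' hβ hlog hstep
  have h0 := log_inv_sq_nonneg hg hg1
  have hpow : (Real.log (g ^ 2)⁻¹) ^ p₀ ≤ ((1 + β' * g' ^ 2) * Real.log (g' ^ 2)⁻¹) ^ p₀ := pow_le_pow_left₀ h0 h1 p₀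
  rw [mul_pow] at hpow
  calc A₀ * Real.log (g ^ 2)⁻¹ ^ p₀ ≤ A₀ * ((1 + β' * g' ^ 2) ^ p₀ * Real.log (g' ^ 2)⁻¹ ^ p₀) := mul_le_mul_of_nonneg_left hpow hA
    _ = (1 + β' * g' ^ 2) ^ p₀ * (A₀ * Real.log (g' ^ 2)⁻¹ ^ p₀) := by ring

/-- **★ (2.8) ACROSS ONE SCALE**: along a history `g` with `0 < g_m ≤ 1`, `0 < g_{m+1}`, `g_{m+1}² ≤ e⁻¹`, the one-step control «`g_m ≤ c·g_{m+1}`»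
(print (2.6); `c = 1` when `β ≥ 0`) and «`g_m⁻² ≤ g_{m+1}⁻² + β′`» ((0.20) with `β_{m+1} ≤ β′`) give `ε_m ≤ c·(1 + β′g_{m+1}²)^{p₀}·ε_{m+1}` for the
thresholds `ε_j = g_j A₀(log g_j⁻²)^{p₀}` of (2.4) (`0 ≤ A₀`, `0 ≤ c`, `0 ≤ β′`). [cite: Balaban1988Convergent, (2.4) p.255, (2.6)–(2.8) pp.255–256] -/
theorem epsOfRecord_le_mul_succ_of_step (ν : Stage7Numerics) (hA : 0 ≤ ν.A₀) {g : ℕ → ℝ} {m : ℕ} {c β' : ℝ} (hc : 0 ≤ c) (hβ : 0 ≤ β')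
    (hgm : 0 < g m) (hgm1 : g m ≤ 1) (hgm' : 0 < g (m + 1)) (hge : g (m + 1) ^ 2 ≤ Real.exp (-1))
    (hratio : g m ≤ c * g (m + 1)) (hstep : (g m ^ 2)⁻¹ ≤ (g (m + 1) ^ 2)⁻¹ + β') :
    epsOfRecord ν g m ≤ c * (1 + β' * g (m + 1) ^ 2) ^ ν.p₀ * epsOfRecord ν g (m + 1) := by
  unfold epsOfRecord
  have hlog : 1 ≤ Real.log (g (m + 1) ^ 2)⁻¹ := one_le_log_inv_sq hgm' hge
  have hprof := p0Profile_le_of_step (p₀ := ν.p₀) hA hgm hgm1 hgm' hβ hlog hstep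
  have hprof0 : 0 ≤ p0Profile ν.A₀ ν.p₀ (g m) := by
    unfold p0Profile; exact mul_nonneg hA (pow_nonneg (log_inv_sq_nonneg hgm hgm1) _)
  have hprof'0 : 0 ≤ p0Profile ν.A₀ ν.p₀ (g (m + 1)) := by
    unfold p0Profile; exact mul_nonneg hA (pow_nonneg (zero_le_one.trans hlog) _)
  calc g m * p0Profile ν.A₀ ν.p₀ (g m)
      ≤ (c * g (m + 1)) * ((1 + β' * g (m + 1) ^ 2) ^ ν.p₀ * p0Profile ν.A₀ ν.p₀ (g (m + 1))) :=
        mul_le_mul hratio hprof hprof0 (by positivity)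
    _ = c * (1 + β' * g (m + 1) ^ 2) ^ ν.p₀ * (g (m + 1) * p0Profile ν.A₀ ν.p₀ (g (m + 1))) := by ring

/-- **THE COMPARABILITY CLAUSE ACROSS ONE SCALE UNDER ONE LETTER**: with `g_{m+1} ≤ γ` (`0 ≤ γ`) and `c·(1 + β′γ²)^{p₀} ≤ 2`, the step hypotheses give
`ε_m ≤ 2·ε_{m+1}` — the `hcomp` of `VariationalThm1ScaledSep`'s consumers at the pair `(m, m+1)` (with `g_{m+1} ≤ γ`). [cite: Balaban1988Convergent, (2.6)–(2.8) pp.255–256] -/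
theorem epsOfRecord_le_two_mul_succ_of_step (ν : Stage7Numerics) (hA : 0 ≤ ν.A₀) {g : ℕ → ℝ} {m : ℕ} {c β' γ : ℝ} (hc : 0 ≤ c) (hβ : 0 ≤ β')
    (hletter : c * (1 + β' * γ ^ 2) ^ ν.p₀ ≤ 2)
    (hgm : 0 < g m) (hgm1 : g m ≤ 1) (hgm' : 0 < g (m + 1)) (hgγ : g (m + 1) ≤ γ) (hge : g (m + 1) ^ 2 ≤ Real.exp (-1))
    (hratio : g m ≤ c * g (m + 1)) (hstep : (g m ^ 2)⁻¹ ≤ (g (m + 1) ^ 2)⁻¹ + β') :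
    epsOfRecord ν g m ≤ 2 * epsOfRecord ν g (m + 1) := by
  have h := epsOfRecord_le_mul_succ_of_step ν hA hc hβ hgm hgm1 hgm' hge hratio hstep
  have heps0 : 0 ≤ epsOfRecord ν g (m + 1) := by
    unfold epsOfRecord p0Profile
    exact mul_nonneg hgm'.le (mul_nonneg hA (pow_nonneg (zero_le_one.trans (one_le_log_inv_sq hgm' hge)) _))
  have hfac : c * (1 + β' * g (m + 1) ^ 2) ^ ν.p₀ ≤ 2 := by
    refine le_trans ?_ hletter
    have : g (m + 1) ^ 2 ≤ γ ^ 2 := pow_le_pow_left₀ hgm'.le hgγ 2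
    gcongr
  exact h.trans (mul_le_mul_of_nonneg_right hfac heps0)

end Step

/-! ## §2  The monotone regime: `x ↦ x·(log x⁻²)^{p₀}` increases on `]0, e^{−p₀}]` -/

section Monotone

/-- **`x ↦ x·(log x⁻²)^{p₀}` IS INCREASING ON `]0, e^{−p₀}]`**: for `0 < x ≤ y ≤ e^{−p₀}` put `u = log x⁻² ≥ v = log y⁻² ≥ 2p₀`; then
`(u∕v)^{p₀} = (1 + (u−v)∕v)^{p₀} ≤ e^{p₀(u−v)∕v} ≤ e^{(u−v)∕2} = (x∕y)⁻¹·…`, i.e. `x·u^{p₀} ≤ y·v^{p₀}` (`1 + t ≤ eᵗ`). [cite: Balaban1988Convergent, (2.4) p.255 (elementary)] -/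
theorem mul_log_inv_sq_pow_mono {x y : ℝ} {p₀ : ℕ} (hx : 0 < x) (hxy : x ≤ y) (hy : y ≤ Real.exp (-(p₀ : ℝ))) :
    x * (Real.log (x ^ 2)⁻¹) ^ p₀ ≤ y * (Real.log (y ^ 2)⁻¹) ^ p₀ := by
  have hy0 : 0 < y := hx.trans_le hxy
  -- `u = log x⁻² = -2 log x`, `v = log y⁻² = -2 log y`
  have hu : Real.log (x ^ 2)⁻¹ = -2 * Real.log x := by rw [Real.log_inv, Real.log_pow]; push_cast; ring
  have hv : Real.log (y ^ 2)⁻¹ = -2 * Real.log y := by rw [Real.log_inv, Real.log_pow]; push_cast; ring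
  have hlogy : Real.log y ≤ -(p₀ : ℝ) := by
    have := Real.log_le_log hy0 hy
    rwa [Real.log_exp] at this
  have hlogxy : Real.log x ≤ Real.log y := Real.log_le_log hx hxy
  set u := Real.log (x ^ 2)⁻¹ with hu_def
  set v := Real.log (y ^ 2)⁻¹ with hv_def
  have hv2p : 2 * (p₀ : ℝ) ≤ v := by rw [hv]; linarith
  have hvu : v ≤ u := by rw [hu, hv]; linarith
  have hp0 : (0 : ℝ) ≤ p₀ := Nat.cast_nonneg _
  rcases Nat.eq_zero_or_pos p₀ with hp | hp
  · subst hp; simpa using hxy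
  have hv0 : 0 < v := by
    have : (0 : ℝ) < p₀ := by exact_mod_cast hp
    linarith
  have hu0 : 0 < u := hv0.trans_le hvu
  -- the key inequality `(u/v)^{p₀} ≤ exp ((u - v)/2)`
  have hkey : (u / v) ^ p₀ ≤ Real.exp ((u - v) / 2) := by
    have h1 : u / v = 1 + (u - v) / v := by field_simp; ring
    have h2 : u / v ≤ Real.exp ((u - v) / v) := by
      rw [h1]
      have := Real.add_one_le_exp ((u - v) / v)
      linarith
    have h3 : (u / v) ^ p₀ ≤ (Real.exp ((u - v) / v)) ^ p₀ := pow_le_pow_left₀ (div_nonneg hu0.le hv0.le) h2 p₀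
    refine h3.trans ?_
    rw [← Real.exp_nat_mul]
    apply Real.exp_le_exp.mpr
    -- `p₀ * ((u - v)/v) ≤ (u - v)/2` since `2 p₀ ≤ v` and `0 ≤ u - v`
    rw [mul_div_assoc', div_le_div_iff₀ hv0 (by norm_num : (0 : ℝ) < 2)]
    have huv : 0 ≤ u - v := sub_nonneg.mpr hvu
    nlinarith
  -- `exp ((u - v)/2) = y / x`
  have hexp : Real.exp ((u - v) / 2) = y / x := by
    have : (u - v) / 2 = Real.log y - Real.log x := by rw [hu, hv]; ring
    rw [this, Real.exp_sub, Real.exp_log hy0, Real.exp_log hx]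
  rw [hexp] at hkey
  -- conclude: `x u^{p₀} ≤ y v^{p₀}` iff `(u/v)^{p₀} ≤ y/x`
  have hvp : 0 < v ^ p₀ := pow_pos hv0 _
  have h4 : u ^ p₀ ≤ y / x * v ^ p₀ := by
    have := mul_le_mul_of_nonneg_right hkey hvp.le
    rwa [div_pow, div_mul_cancel₀ _ (ne_of_gt hvp)] at this
  calc x * u ^ p₀ ≤ x * (y / x * v ^ p₀) := mul_le_mul_of_nonneg_left h4 hx.le
    _ = y * v ^ p₀ := by field_simp

/-- **`ε` IS MONOTONE ALONG A NON-DECREASING HISTORY IN THE SMALL WINDOW `]0, e^{−p₀}]`**: `0 < g_m ≤ g_{m+1} ≤ e^{−p₀}` and `0 ≤ A₀` give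
`ε_m ≤ ε_{m+1}` (hence `≤ 2ε_{m+1}`). [cite: Balaban1988Convergent, (2.4) p.255, (2.6)–(2.8) pp.255–256] -/
theorem epsOfRecord_le_of_le (ν : Stage7Numerics) (hA : 0 ≤ ν.A₀) {g : ℕ → ℝ} {m m' : ℕ} (hgm : 0 < g m) (hle : g m ≤ g m')
    (hsmall : g m' ≤ Real.exp (-(ν.p₀ : ℝ))) : epsOfRecord ν g m ≤ epsOfRecord ν g m' := by
  unfold epsOfRecord p0Profile
  have h := mul_log_inv_sq_pow_mono (p₀ := ν.p₀) hgm hle hsmall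
  calc g m * (ν.A₀ * Real.log (g m ^ 2)⁻¹ ^ ν.p₀) = ν.A₀ * (g m * Real.log (g m ^ 2)⁻¹ ^ ν.p₀) := by ring
    _ ≤ ν.A₀ * (g m' * Real.log (g m' ^ 2)⁻¹ ^ ν.p₀) := mul_le_mul_of_nonneg_left h hA
    _ = g m' * (ν.A₀ * Real.log (g m' ^ 2)⁻¹ ^ ν.p₀) := by ring

end Monotone

/-! ## §3  Along the generated history `genSeq β g₀` of (0.20): the clause from the window + a one-step β-box -/

section GenSeq

/-- **THE RG STEP IN THE WINDOW**: if `g_{m+1} = genSeq β g₀ (m+1) > 0` then `g_{m+1}⁻² = g_m⁻² − β_m(g₀,…,g_m)` ((0.20); the positive branch of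
`solveCoupling`). [cite: Balaban1987RG1, (0.18)–(0.20) pp.255–256] -/
theorem inv_sq_genSeq_succ (β : HBeta) (g0 : ℝ) {m : ℕ} (hpos : 0 < genSeq β g0 (m + 1)) :
    (genSeq β g0 (m + 1) ^ 2)⁻¹ = (genSeq β g0 m ^ 2)⁻¹ - β m (prefixOf (genSeq β g0) m) := by
  rw [genSeq_succ] at hpos ⊢
  set y := 1 / (genSeq β g0 m) ^ 2 - β m (prefixOf (genSeq β g0) m) with hy
  have hy0 : 0 < y := by
    by_contra h
    exact absurd (solveCoupling_nonpos (not_lt.mp h)) (not_le.mpr hpos)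
  have h := inv_sq_solveCoupling hy0
  rw [one_div] at h
  rw [h, hy, one_div]

/-- **★ THE COMPARABILITY CLAUSE ALONG `genSeq β g₀` FROM THE WINDOW AND A ONE-STEP β-BOX** (print (2.6)–(2.8): «from the renormalization group
equations (0.20) and from the properties of the β-functions»): if `0 < g_j ≤ γ` for `j ≤ n` (`Step.InInterval γ n`), `γ ≤ 1`, `γ² ≤ e⁻¹`, the
β-functions satisfy `0 ≤ β_j ≤ β′` on the boxes `]0,γ]^{j+1}` (`FlowStep.BetaLowerH 0 γ β`, `FlowStep.BetaUpperH β′ γ β` — DISPLAYED; the sign is the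
tree's unprinted (AF) input, the upper bound print's p. 264 «uniformly bounded»), `0 ≤ A₀`, and the ONE letter `(1 + β′γ²)^{p₀} ≤ 2` holds, then
`ε_m ≤ 2·ε_{m+1}` for every `m < n`. [cite: Balaban1988Convergent, (2.6)–(2.8) pp.255–256; Balaban1987RG1, (0.20) p.256, §1 p.264] -/
theorem hcomp_genSeq_of_betaBox (ν : Stage7Numerics) (hA : 0 ≤ ν.A₀) {β : HBeta} {g0 γ β' : ℝ} {n : ℕ}
    (hI : Step.InInterval γ n (genSeq β g0)) (hγ1 : γ ≤ 1) (hγe : γ ^ 2 ≤ Real.exp (-1)) (hβ' : 0 ≤ β')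
    (hlo : BetaLowerH 0 γ β) (hup : BetaUpperH β' γ β) (hletter : (1 + β' * γ ^ 2) ^ ν.p₀ ≤ 2) :
    ∀ m, m < n → epsOfRecord ν (genSeq β g0) m ≤ 2 * epsOfRecord ν (genSeq β g0) (m + 1) := by
  intro m hm
  have hgm := hI m hm.le
  have hgm' := hI (m + 1) hm
  -- the prefix `(g_0,…,g_m)` lies in the box
  have hbox : prefixOf (genSeq β g0) m ∈ Box γ m :=
    mem_box.mpr fun i => hI i (by have := i.isLt; omega)
  have hβlo : 0 ≤ β m (prefixOf (genSeq β g0) m) := hlo m _ hbox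
  have hβup : β m (prefixOf (genSeq β g0) m) ≤ β' := hup m _ hbox
  -- (2.6) with `c = 1`: the history does not decrease
  have hratio : genSeq β g0 m ≤ 1 * genSeq β g0 (m + 1) := by
    rw [one_mul]; exact genSeq_le_succ_of_beta_nonneg β g0 hgm.1 hgm'.1 hβlo
  -- (0.20): `g_m⁻² = g_{m+1}⁻² + β_m ≤ g_{m+1}⁻² + β′`
  have hstep : (genSeq β g0 m ^ 2)⁻¹ ≤ (genSeq β g0 (m + 1) ^ 2)⁻¹ + β' := by
    rw [inv_sq_genSeq_succ β g0 hgm'.1]; linarith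
  have hge : genSeq β g0 (m + 1) ^ 2 ≤ Real.exp (-1) := (pow_le_pow_left₀ hgm'.1.le hgm'.2 2).trans hγe
  exact epsOfRecord_le_two_mul_succ_of_step ν hA zero_le_one hβ' (by rwa [one_mul]) hgm.1 (hgm.2.trans hγ1) hgm'.1 hgm'.2 hge
    hratio hstep

/-- **THE CLAUSE IN THE SMALL WINDOW FROM THE SIGN ALONE**: if `0 < g_j ≤ γ ≤ e^{−p₀}` for `j ≤ n` and `β_j ≥ 0` on the boxes (`BetaLowerH b γ β`, `0 ≤ b`),
then the history does not decrease and `ε` is monotone there: `ε_m ≤ ε_{m+1} ≤ 2ε_{m+1}` for `m < n` (`0 ≤ A₀`). [cite: Balaban1988Convergent, (2.4) p.255, (2.6)–(2.8) pp.255–256; Balaban1987RG1, (0.20) p.256] -/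
theorem hcomp_genSeq_of_betaLowerH_small (ν : Stage7Numerics) (hA : 0 ≤ ν.A₀) {β : HBeta} {g0 γ b : ℝ} {n : ℕ}
    (hI : Step.InInterval γ n (genSeq β g0)) (hγ : γ ≤ Real.exp (-(ν.p₀ : ℝ))) (hb : 0 ≤ b) (hlo : BetaLowerH b γ β) :
    ∀ m, m < n → epsOfRecord ν (genSeq β g0) m ≤ 2 * epsOfRecord ν (genSeq β g0) (m + 1) := by
  intro m hm
  have hgm := hI m hm.le
  have hgm' := hI (m + 1) hm
  have hβ := betaAlongHistory_nonneg_of_betaLowerH hb hlo hI m hm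
  have hle : genSeq β g0 m ≤ genSeq β g0 (m + 1) := genSeq_le_succ_of_beta_nonneg β g0 hgm.1 hgm'.1 hβ
  have h := epsOfRecord_le_of_le ν hA hgm.1 hle (hgm'.2.trans hγ)
  have heps0 : 0 ≤ epsOfRecord ν (genSeq β g0) (m + 1) := by
    have h0 : 0 ≤ epsOfRecord ν (genSeq β g0) m := by
      unfold epsOfRecord p0Profile
      exact mul_nonneg hgm.1.le (mul_nonneg hA (pow_nonneg (log_inv_sq_nonneg hgm.1
        (hgm.2.trans (hγ.trans (by have := Real.exp_le_one_iff.mpr (by simp : -(ν.p₀ : ℝ) ≤ 0); exact this)))) _))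
    exact h0.trans h
  linarith

/-- The `cR`-form displayed by FILE 5 v1.2 `bgRowAt_of_thm1ScaledSep (hcomp)` and node00-def-K0a's 11b `bgSep_of_thm1ScaledSep (hcomp)`: multiply the
clause by `0 ≤ cR`. [cite: Balaban1988Convergent, (2.8) p.256 (bookkeeping)] -/
theorem hcomp_mul_of_hcomp (ν : Stage7Numerics) {g : ℕ → ℝ} {n : ℕ} {cR : ℝ} (hcR : 0 ≤ cR)
    (h : ∀ m, m < n → epsOfRecord ν g m ≤ 2 * epsOfRecord ν g (m + 1)) :
    ∀ m, m < n → cR * epsOfRecord ν g m ≤ 2 * (cR * epsOfRecord ν g (m + 1)) := fun m hm => by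
  have := mul_le_mul_of_nonneg_left (h m hm) hcR
  linarith

end GenSeq

end Literature.MathematicalPhysics.QuantumFieldTheory.Balaban1983to89.Node00

end
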